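import Mathlib.Topology.Sets.Opens
import Mathlib.Topology.Sober
import Mathlib.Topology.Connected.LocallyConnected
import Mathlib.Topology.Connected.TotallyDisconnected
import Mathlib.Topology.Compactness.Compact
import Mathlib.Topology.Sheaves.SheafCondition.UniqueGluing
import Mathlib.CategoryTheory.Limits.FormalCoproducts.Basic
import Mathlib.CategoryTheory.ObjectProperty.FullSubcategory
import Literature.AlgebraicGeometry.Frobenioids.TopologicalRepresentation
import HarnessLib

/-!
# Frobenioids II, Appendix: proofs of the named facts of `TopologicalRepresentation`

Mochizuki, *The geometry of Frobenioids II*, Kyushu J. Math. **62** (2008), Appendix "Categorical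
Representation of Topological Spaces", author's text pp. 66–68 [cite: MochizukiFrdII2008, Appendix
pp.66-68]. The sibling file `TopologicalRepresentation.lean` types Definition A.1, Theorem A.2 and
Remark A.2.1 and leaves Theorem A.2 (iii) [sheaf part], (iv), (v), (vi) and Remark A.2.1 as NAMED FACTS
(`TopRep.ItemIII_representable_isSheaf`, `TopRep.ItemIV`, `TopRep.ItemV`, `TopRep.ItemVI`,
`TopRep.RmkA21_cofinite`, `TopRep.RmkA21_profinite`). This file DISCHARGES, without touching those
signatures:

* `ItemIII_representable_isSheaf_holds` — a representable presheaf on `Open(X)` is a sheaf (its values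
  are subsingletons; a cover `V = ⋃ Vᵢ` with all `Vᵢ ⊆ U` has `V ⊆ U`);
* `ItemV_holds` — for locally connected `X` the functor `Disjt(Open⁰(X)) → Open(X)` is an equivalence
  (faithful: disjointness of the target collection pins down the index map; full: a connected open inside
  a disjoint union of opens lies in one of them; essentially surjective: every open is the disjoint union
  of its connected components, which are open — the printed argument p. 68);
* `RmkA21_cofinite_holds`, `RmkA21_profinite_holds` — the two halves of Remark A.2.1 (p. 68).

Theorem A.2 (iv) and (vi) (sober spaces) are discharged in the sibling file
`TopologicalRepresentationSober.lean`. Nothing here is specific to Frobenioids; all inputs are Mathlib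
topology.
-/

namespace Literature.AlgebraicGeometry.Frobenioids

open CategoryTheory Topology TopologicalSpace Set Function

universe u

namespace TopRep

variable {X : Type u} [TopologicalSpace X]

/-! ### Theorem A.2 (iii), sheaf part -/

variable (X) in
/-- **Theorem A.2 (iii)**, sheaf part, PROVED (FrdII App. p. 67, "follows immediately from the
definitions"): the presheaf `V ↦ Hom(V, U)` represented by an open `U` is a sheaf on `X` — its values
are subsingletons, and sections over a cover `{Vᵢ}` of `V` (i.e. `Vᵢ ⊆ U` for all `i`) glue to the
unique section `V = ⋃ Vᵢ ⊆ U`. [cite: MochizukiFrdII2008, Thm A.2 (iii) p.67] -/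
theorem ItemIII_representable_isSheaf_holds : ItemIII_representable_isSheaf X := by
  intro U
  rw [TopCat.Presheaf.isSheaf_iff_isSheafUniqueGluing_types]
  intro ι V sf _
  have hs : ∀ W : Opens (TopCat.of X), Subsingleton ((yoneda.obj U).obj (Opposite.op W)) :=
    fun W => inferInstanceAs (Subsingleton (W ⟶ U))
  exact ⟨homOfLE (iSup_le fun i => (sf i).le), fun _ => (hs _).elim _ _,
    fun _ _ => (hs _).elim _ _⟩

/-! ### Remark A.2.1 -/

/-- **Remark A.2.1**, first half, PROVED (FrdII App. p. 68): a countably infinite space whose proper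
closed subsets are exactly the finite subsets is locally connected (any two nonempty opens are cofinite,
hence meet, so every open subset is connected) but not sober (`X` itself is irreducible, yet the closure
of a point is that point). [cite: MochizukiFrdII2008, Rmk A.2.1 p.68] -/
theorem RmkA21_cofinite_holds : RmkA21_cofinite := by
  intro Z _ _ _ hcl
  have hopen : ∀ U : Set Z, IsOpen U → U.Nonempty → Uᶜ.Finite := by
    intro U hU hne
    rcases (hcl Uᶜ).mp hU.isClosed_compl with h | h
    · exact absurd (compl_univ_iff.mp h) hne.ne_empty
    · exact h
  have hmeet : ∀ U V : Set Z, IsOpen U → IsOpen V → U.Nonempty → V.Nonempty →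
      (U ∩ V).Nonempty := by
    intro U V hU hV hUn hVn
    have hfin : (U ∩ V)ᶜ.Finite := by
      rw [compl_inter]
      exact (hopen U hU hUn).union (hopen V hV hVn)
    by_contra h
    rw [not_nonempty_iff_eq_empty] at h
    rw [h, compl_empty] at hfin
    exact infinite_univ hfin
  refine ⟨?_, fun hs => ?_⟩
  · rw [← isLocallyConnected_iff_locallyConnectedSpace]
    refine ⟨fun U hU x hx => ⟨U, hU, ⟨⟨x, hx⟩, ?_⟩, hx, subset_rfl⟩⟩
    intro A B hA hB _ hUA hUB
    rw [inter_inter_distrib_left]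
    exact hmeet _ _ (hU.inter hA) (hU.inter hB) hUA hUB
  · have hirr : IsIrreducible (univ : Set Z) :=
      ⟨univ_nonempty, fun A B hA hB hA' hB' => by
        simpa only [univ_inter] using hmeet A B hA hB (by simpa using hA') (by simpa using hB')⟩
    obtain ⟨x, ⟨-, hx⟩, -⟩ := hs.existsUnique_generic univ hirr isClosed_univ
    have hxc : IsClosed ({x} : Set Z) := (hcl {x}).mpr (Or.inr (finite_singleton x))
    rw [hxc.closure_eq] at hx
    exact infinite_univ (hx ▸ finite_singleton x)

/-- **Remark A.2.1**, second half, PROVED (FrdII App. p. 68): an infinite profinite set (compact,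
Hausdorff, totally disconnected) is sober (Hausdorff spaces are sober) but not locally connected
(its connected components are points; were they open, the space would be an infinite compact discrete
space). [cite: MochizukiFrdII2008, Rmk A.2.1 p.68] -/
theorem RmkA21_profinite_holds : RmkA21_profinite := by
  intro Z _ _ _ _ _
  refine ⟨(isSober_iff_quasiSober Z).mpr ⟨inferInstance, inferInstance⟩, fun _ => ?_⟩
  have hd : DiscreteTopology Z := discreteTopology_iff_isOpen_singleton.mpr fun z => by
    rw [← connectedComponent_eq_singleton z]
    exact isOpen_connectedComponent
  have : Finite Z := finite_of_compact_of_discrete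
  exact not_finite Z

/-! ### Theorem A.2 (v): `Disjt(Open⁰(X)) → Open(X)` is an equivalence for locally connected `X` -/

/-- Hom-sets of `Open⁰(X)` are subsingletons (arrows are inclusions).
[cite: MochizukiFrdII2008, Appendix p.66] -/
theorem Open0.hom_eq {A B : Open0 X} (f g : A ⟶ B) : f = g :=
  (ObjectProperty.ι (connectedOpens X)).map_injective (Subsingleton.elim _ _)

/-- Membership in the open `union F = ⋃ᵢ Uᵢ` attached to a collection of disjoint objects.
[cite: MochizukiFrdII2008, Def A.1 (iii) p.67] -/
theorem mem_union_obj_iff (F : Disjt X) (x : X) :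
    x ∈ (union X).obj F ↔ ∃ i, x ∈ ((F.obj.obj i).obj : Set X) := by
  change x ∈ (⨆ i, (F.obj.obj i).obj : Opens X) ↔ _
  rw [Opens.mem_iSup]
  rfl

/-- `Disjt(Open⁰(X)) → Open(X)` is faithful (for any `X`): two arrows `{Uᵢ} → {Vⱼ}` over the same
inclusion have the same index map, since `Uᵢ` maps to both `V_{f(i)}` and `V_{g(i)}`, which for
`f(i) ≠ g(i)` is excluded by the disjointness of `{Vⱼ}` (Def. A.1 (ii)); the component arrows are
inclusions. [cite: MochizukiFrdII2008, Thm A.2 (v) p.67] -/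
theorem union_faithful : (union X).Faithful where
  map_injective := by
    intro F G f g _
    apply ObjectProperty.hom_ext
    refine Limits.FormalCoproduct.hom_ext ?_ fun i => Open0.hom_eq _ _
    funext i
    by_contra hne
    exact G.property.2 hne (F.obj.obj i) ⟨⟨f.hom.φ i⟩, ⟨g.hom.φ i⟩⟩

/-- In a locally connected space, a connected open contained in the union `⋃ⱼ Vⱼ` of a collection of
disjoint objects `{Vⱼ}` of `Open⁰(X)` is contained in a single `Vⱼ` (the `Vⱼ` are pairwise disjoint
as sets by Remark A.1.1). [cite: MochizukiFrdII2008, Thm A.2 (v) pp.67-68] -/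
theorem exists_le_of_le_union [LocallyConnectedSpace X] (C : Open0 X) (G : Disjt X)
    (h : C.obj ≤ (union X).obj G) : ∃ j, C.obj ≤ (G.obj.obj j).obj := by
  have hdisj := (isDisjointCollection_iff_pairwise_disjoint G.obj.obj G.property.1).mp G.property
  have hC : ((C.obj : Set X)) ⊆ ⋃ j, ((G.obj.obj j).obj : Set X) := fun x hx =>
    mem_iUnion.mpr ((mem_union_obj_iff G x).mp (h hx))
  obtain ⟨x, hx⟩ := C.property.nonempty
  obtain ⟨j, hj⟩ := mem_iUnion.mp (hC hx)
  refine ⟨j, C.property.isPreconnected.subset_left_of_subset_union (G.obj.obj j).obj.isOpen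
    (isOpen_iUnion fun j' => isOpen_iUnion fun (_ : j' ≠ j) => (G.obj.obj j').obj.isOpen)
    ?_ ?_ ⟨x, hx, hj⟩⟩
  · rw [disjoint_iUnion_right]
    intro j'
    rw [disjoint_iUnion_right]
    intro hj'
    exact hdisj (Ne.symm hj')
  · intro y hy
    obtain ⟨j', hj'⟩ := mem_iUnion.mp (hC hy)
    by_cases hjj : j' = j
    · exact Or.inl (hjj ▸ hj')
    · exact Or.inr (mem_iUnion.mpr ⟨j', mem_iUnion.mpr ⟨hjj, hj'⟩⟩)

/-- `Disjt(Open⁰(X)) → Open(X)` is full for locally connected `X`: an inclusion `⋃ Uᵢ ⊆ ⋃ Vⱼ` sends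
each connected `Uᵢ` into a single `Vⱼ`. [cite: MochizukiFrdII2008, Thm A.2 (v) pp.67-68] -/
theorem union_full [LocallyConnectedSpace X] : (union X).Full where
  map_surjective {F G} := fun h => by
    have key : ∀ i, ∃ j, (F.obj.obj i).obj ≤ (G.obj.obj j).obj := fun i =>
      exists_le_of_le_union (F.obj.obj i) G
        ((le_iSup (fun i => (F.obj.obj i).obj) i).trans h.le)
    choose g hg using key
    exact ⟨ObjectProperty.homMk
      (Limits.FormalCoproduct.Hom.mk g fun i => ObjectProperty.homMk (homOfLE (hg i))),
      Subsingleton.elim _ _⟩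

/-- "Every open `V` of `X` is a disjoint union of connected opens of `X`" (FrdII App. p. 68, the claim
in the proof of Theorem A.2 (v)): for locally connected `X`, the connected components of `V` — which are
open — form a collection of disjoint objects of `Open⁰(X)` indexed by the set of components, with union
`V`; moreover each member is a connected component of `V`. Stated as an existence result (no auxiliary
definitions). [cite: MochizukiFrdII2008, Thm A.2 (v) p.68] -/
theorem exists_disjt_union_eq [LocallyConnectedSpace X] (V : Opens X) :
    ∃ F : Disjt X, (union X).obj F = V ∧
      ∀ i, ∃ x ∈ (V : Set X), ((F.obj.obj i).obj : Set X) = connectedComponentIn (V : Set X) x := by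
  -- index set: the connected components of `V`, as a set of subsets of `X`
  let I : Type u := {C : Set X // ∃ x ∈ (V : Set X), C = connectedComponentIn (V : Set X) x}
  have hopen : ∀ C : I, IsOpen C.1 := fun C => by
    obtain ⟨x, _, hC⟩ := C.2
    exact hC ▸ V.isOpen.connectedComponentIn
  have hconn : ∀ C : I, IsConnected C.1 := fun C => by
    obtain ⟨x, hx, hC⟩ := C.2
    exact hC ▸ isConnected_connectedComponentIn_iff.mpr hx
  let A : I → Open0 X := fun C => ⟨⟨C.1, hopen C⟩, hconn C⟩
  have hinj : Injective A := by
    intro C D hCD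
    apply Subtype.ext
    exact congrArg (fun B : Open0 X => ((B.obj : Opens X) : Set X)) hCD
  have hdisj : IsDisjointCollection A := by
    refine (isDisjointCollection_iff_pairwise_disjoint _ hinj).mpr fun C D hCD => ?_
    change Disjoint (C.1 : Set X) D.1
    rw [Set.disjoint_iff]
    rintro z ⟨hzC, hzD⟩
    obtain ⟨x, _, hC⟩ := C.2
    obtain ⟨y, _, hD⟩ := D.2
    refine hCD (Subtype.ext ?_)
    rw [hC, hD, connectedComponentIn_eq (hC ▸ hzC : z ∈ connectedComponentIn (V : Set X) x),
      connectedComponentIn_eq (hD ▸ hzD : z ∈ connectedComponentIn (V : Set X) y)]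
  refine ⟨⟨⟨I, A⟩, hdisj⟩, ?_, fun C => ?_⟩
  · ext x
    rw [SetLike.mem_coe, SetLike.mem_coe, mem_union_obj_iff]
    constructor
    · rintro ⟨C, hC⟩
      obtain ⟨y, _, hCy⟩ := C.2
      have hx : x ∈ C.1 := hC
      rw [hCy] at hx
      exact connectedComponentIn_subset _ _ hx
    · intro hx
      exact ⟨⟨connectedComponentIn (V : Set X) x, x, hx, rfl⟩, mem_connectedComponentIn hx⟩
  · obtain ⟨x, hx, hC⟩ := C.2
    exact ⟨x, hx, hC⟩

/-- `Disjt(Open⁰(X)) → Open(X)` is essentially surjective for locally connected `X`.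
[cite: MochizukiFrdII2008, Thm A.2 (v) p.68] -/
theorem union_essSurj [LocallyConnectedSpace X] : (union X).EssSurj where
  mem_essImage V := by
    obtain ⟨F, hF, -⟩ := exists_disjt_union_eq V
    exact ⟨F, ⟨eqToIso hF⟩⟩

variable (X) in
/-- **Theorem A.2 (v)**, PROVED (FrdII App. pp. 67–68): for locally connected `X` the natural functor
`Disjt(Open⁰(X)) → Open(X)` is an equivalence of categories (faithful, full and essentially surjective
as above). [cite: MochizukiFrdII2008, Thm A.2 (v) p.67] -/
theorem ItemV_holds : ItemV X := fun _ =>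
  haveI := union_faithful (X := X)
  haveI := union_full (X := X)
  haveI := union_essSurj (X := X)
  { }

end TopRep

end Literature.AlgebraicGeometry.Frobenioids
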